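import Literature.NumberTheory.Sieve.DivisorBound
import Literature.NumberTheory.Sieve.BombieriAsymptoticSieveMertens
import Literature.NumberTheory.Sieve.BombieriVinogradovReduction
import Literature.NumberTheory.Sieve.ShiuBrunTitchmarsh
import HarnessLib

/-!
# Power moments of the divisor function and divisor-type bounds for Dirichlet convolutions

Trunk `AntSieve`.  Elementary tools, all PROVED, for the assembly of Bombieri–Friedlander–Iwaniec's
Theorem 10 (Acta Math. 156 (1986), §§15–17): there the coefficient sequences `α`, `β` are Dirichlet
convolutions of at most `2J = 14` bounded pieces (truncated Möbius functions and `1`), so they are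
bounded pointwise by powers of `τ` and their moments by the moments of `τ^r` (BFI, p. 246: "the
resulting coefficients are convolutions of the truncated Möbius function and of the constant
function 1; in particular they satisfy the hypotheses of Theorems 1, 2, …", and the trivial estimates
"`≪ x ℒ^B`" throughout, e.g. Lemma 3 p. 211).

* `Literature.NumberTheory.Sieve.sigma_zero_mul_le` — `τ(mn) ≤ τ(m) τ(n)`; `Literature.NumberTheory.Sieve.sigma_zero_le_of_dvd` — `τ(d) ≤ τ(n)` for `d ∣ n ≠ 0`.
* `Literature.NumberTheory.Sieve.abs_mul_apply_le_sigma_zero_pow` — `|F| ≤ A τ^a`, `|G| ≤ B τ^b` ⇒ `|F ⋆ G| ≤ A B τ^{a+b+1}`;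
  `Literature.NumberTheory.Sieve.abs_prod_apply_le_sigma_zero_pow` — `|f_i| ≤ 1` ⇒ `|∏_{i∈s} f_i| ≤ τ^{#s}` (Dirichlet product).
* `Literature.NumberTheory.Sieve.exp_sum_primes_inv_le` — `exp(∑_{p ≤ x} 1/p) ≤ e⁶ log x / log 2` (`x ≥ 2`), from the tree's
  Chebyshev-level Mertens bound `∏_{p ≤ x} (1 + 1/p) ≤ e⁵ log x / log 2`.
* `Literature.NumberTheory.Sieve.exists_sum_sigma_zero_pow_div_le` — `∑_{n ≤ X} τ(n)^r / n ≤ C_r (log X)^{2^{r+1}}` (`X ≥ 2`),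
  by Rankin/Euler-product majorisation (Montgomery–Vaughan §2.3 style), and
  `Literature.NumberTheory.Sieve.exists_sum_sigma_zero_pow_le` — `∑_{n ≤ X} τ(n)^r ≤ C_r X (log X)^{2^{r+1}}`.
* `Literature.NumberTheory.Sieve.inv_totient_le_sigma_zero_div` — `1/φ(d) ≤ τ(d)/d`.
* `Literature.NumberTheory.Sieve.Shiu1980BrunTitchmarsh.sigma_zero_pow` — Shiu's theorem specialised to `f = τ^r`:
  `∑_{x<n≤x+y, n≡a (q)} τ(n)^r ≤ C y φ(q)⁻¹ (log x)^{2^r − 1}` in Shiu's range.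

The exponents of `log` are not optimal (`2^{r+1}` for `2^r − 1`); only polynomial growth in `log`
is used downstream.

## References

* H. L. Montgomery, R. C. Vaughan, *Multiplicative Number Theory I*, CUP 2007, §2.3 (divisor moments),
  §7.1 (Rankin's method). [MontgomeryVaughan2007]
* P. Shiu, J. reine angew. Math. 313 (1980), 161–170, Theorem 1. [Shiu1980]
* E. Bombieri, J. B. Friedlander, H. Iwaniec, Acta Math. 156 (1986), §2 Lemma 3 p. 211, §15 p. 246.
  [BombieriFriedlanderIwaniecActa1986]
-/

open Finset Real
open scoped ArithmeticFunction.sigma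

namespace Literature.NumberTheory.Sieve

/-! ### `τ` is submultiplicative; divisor bounds for Dirichlet convolutions -/

/-- `τ(mn) ≤ τ(m) τ(n)` for all `m, n` (every divisor of `mn` is a product of a divisor of `m` and
one of `n`). [folklore] -/
theorem sigma_zero_mul_le (m n : ℕ) : σ 0 (m * n) ≤ σ 0 m * σ 0 n := by
  simp only [ArithmeticFunction.sigma_zero_apply]
  rw [Nat.divisors_mul]
  exact Finset.card_mul_le

/-- `τ(d) ≤ τ(n)` for `d ∣ n`, `n ≠ 0`. [folklore] -/
theorem sigma_zero_le_of_dvd {d n : ℕ} (hn : n ≠ 0) (hd : d ∣ n) : σ 0 d ≤ σ 0 n := by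
  simp only [ArithmeticFunction.sigma_zero_apply]
  exact Finset.card_le_card (Nat.divisors_subset_of_dvd hn hd)

/-- `1 ≤ τ(n)` for `n ≠ 0`. [folklore] -/
theorem one_le_sigma_zero {n : ℕ} (hn : n ≠ 0) : 1 ≤ σ 0 n := by
  rw [ArithmeticFunction.sigma_zero_apply]
  exact Finset.card_pos.2 ⟨1, Nat.one_mem_divisors.2 hn⟩

/-- **Divisor bound for a Dirichlet product of two functions**: if `|F(d)| ≤ A τ(d)^a` and
`|G(e)| ≤ B τ(e)^b` for all `d, e`, then `|(F ⋆ G)(n)| ≤ A B τ(n)^{a+b+1}` (the `τ(n)` factorisations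
`n = de`, and `τ(d), τ(e) ≤ τ(n)`). [folklore] -/
theorem abs_mul_apply_le_sigma_zero_pow {F G : ArithmeticFunction ℝ} {A B : ℝ} {a b : ℕ}
    (hA : 0 ≤ A) (hB : 0 ≤ B) (hF : ∀ d, |F d| ≤ A * (σ 0 d : ℝ) ^ a)
    (hG : ∀ e, |G e| ≤ B * (σ 0 e : ℝ) ^ b) (n : ℕ) :
    |(F * G) n| ≤ A * B * (σ 0 n : ℝ) ^ (a + b + 1) := by
  rcases eq_or_ne n 0 with rfl | hn
  · simp
  rw [ArithmeticFunction.mul_apply]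
  calc |∑ x ∈ n.divisorsAntidiagonal, F x.1 * G x.2|
      ≤ ∑ x ∈ n.divisorsAntidiagonal, |F x.1 * G x.2| := Finset.abs_sum_le_sum_abs _ _
    _ ≤ ∑ x ∈ n.divisorsAntidiagonal, A * B * (σ 0 n : ℝ) ^ (a + b) := by
        refine Finset.sum_le_sum fun x hx => ?_
        obtain ⟨hxn, -⟩ := Nat.mem_divisorsAntidiagonal.1 hx
        have h1 : x.1 ∣ n := ⟨x.2, hxn.symm⟩
        have h2 : x.2 ∣ n := ⟨x.1, by rw [mul_comm]; exact hxn.symm⟩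
        have hτ1 : (σ 0 x.1 : ℝ) ≤ σ 0 n := by exact_mod_cast sigma_zero_le_of_dvd hn h1
        have hτ2 : (σ 0 x.2 : ℝ) ≤ σ 0 n := by exact_mod_cast sigma_zero_le_of_dvd hn h2
        rw [abs_mul, pow_add]
        calc |F x.1| * |G x.2| ≤ (A * (σ 0 x.1 : ℝ) ^ a) * (B * (σ 0 x.2 : ℝ) ^ b) :=
              mul_le_mul (hF _) (hG _) (abs_nonneg _) (by positivity)
          _ ≤ (A * (σ 0 n : ℝ) ^ a) * (B * (σ 0 n : ℝ) ^ b) := by gcongr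
          _ = A * B * ((σ 0 n : ℝ) ^ a * (σ 0 n : ℝ) ^ b) := by ring
    _ = (σ 0 n : ℝ) * (A * B * (σ 0 n : ℝ) ^ (a + b)) := by
        rw [Finset.sum_const, nsmul_eq_mul, ← Nat.map_div_right_divisors, Finset.card_map,
          ArithmeticFunction.sigma_zero_apply]
    _ = A * B * (σ 0 n : ℝ) ^ (a + b + 1) := by ring

/-- **Divisor bound for a Dirichlet product of bounded functions**: if `|f_i(n)| ≤ 1` for all
`i ∈ s` and all `n`, then `|(∏_{i ∈ s} f_i)(n)| ≤ τ(n)^{#s}` (Dirichlet product in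
`ArithmeticFunction ℝ`; e.g. `|μ_{≤U}^{⋆j} ⋆ 1^{⋆(j−1)}| ≤ τ^{2j−1}` for the Heath-Brown pieces).
[folklore] -/
theorem abs_prod_apply_le_sigma_zero_pow {ι : Type*} [DecidableEq ι] (s : Finset ι)
    (f : ι → ArithmeticFunction ℝ) (hf : ∀ i ∈ s, ∀ n, |f i n| ≤ 1) (n : ℕ) :
    |(∏ i ∈ s, f i) n| ≤ (σ 0 n : ℝ) ^ s.card := by
  induction s using Finset.induction_on generalizing n with
  | empty =>
      rw [Finset.prod_empty, Finset.card_empty, pow_zero, ArithmeticFunction.one_apply]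
      split_ifs <;> simp
  | @insert i s hi ih =>
      rw [Finset.prod_insert hi, Finset.card_insert_of_notMem hi]
      have hF : ∀ d, |f i d| ≤ 1 * (σ 0 d : ℝ) ^ 0 := fun d => by
        simpa using hf i (Finset.mem_insert_self i s) d
      have hG : ∀ e, |(∏ j ∈ s, f j) e| ≤ 1 * (σ 0 e : ℝ) ^ s.card := fun e => by
        simpa using ih (fun j hj => hf j (Finset.mem_insert_of_mem hj)) e
      have := abs_mul_apply_le_sigma_zero_pow zero_le_one zero_le_one hF hG n
      simpa [add_comm] using this

/-! ### `1/φ(d) ≤ τ(d)/d` -/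

/-- `1/φ(d) ≤ τ(d)/d` for every `d` (`d ≤ φ(d) τ(d)`, tree lemma
`self_le_totient_mul_card_divisors`; both sides vanish at `d = 0`). [folklore] -/
theorem inv_totient_le_sigma_zero_div (d : ℕ) : ((Nat.totient d : ℝ))⁻¹ ≤ (σ 0 d : ℝ) / d := by
  rcases eq_or_ne d 0 with rfl | hd
  · simp
  have hφ : (0 : ℝ) < Nat.totient d := by exact_mod_cast Nat.totient_pos.2 (Nat.pos_of_ne_zero hd)
  have hd0 : (0 : ℝ) < d := by exact_mod_cast Nat.pos_of_ne_zero hd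
  rw [inv_eq_one_div, div_le_div_iff₀ hφ hd0, one_mul, ArithmeticFunction.sigma_zero_apply, mul_comm]
  exact_mod_cast Sieve.self_le_totient_mul_card_divisors d

/-! ### Mertens-type bound for `exp (∑_{p ≤ x} 1/p)` -/

/-- `∑_{2 ≤ n ≤ N} 1/n² ≤ 1` (telescoping against `1/(n(n−1))`). [folklore] -/
theorem sum_Icc_inv_sq_le_one (N : ℕ) : ∑ n ∈ Icc 2 N, ((n : ℝ) ^ 2)⁻¹ ≤ 1 := by
  have key : ∀ N : ℕ, ∑ n ∈ Icc 2 N, ((n : ℝ) ^ 2)⁻¹ ≤ 1 - (N : ℝ)⁻¹ ∨ N < 2 := by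
    intro N
    induction N with
    | zero => right; norm_num
    | succ k ih =>
        rcases lt_or_ge (k + 1) 2 with hk | hk
        · exact Or.inr hk
        left
        rcases ih with ih | hk2
        · rw [Finset.sum_Icc_succ_top (by omega), Nat.cast_succ]
          have hk0 : (0 : ℝ) < k := by
            have : 1 ≤ k := by omega
            exact_mod_cast this
          have h1 : (((k : ℝ) + 1) ^ 2)⁻¹ ≤ (k : ℝ)⁻¹ - ((k : ℝ) + 1)⁻¹ := by
            rw [inv_sub_inv hk0.ne' (by positivity), show (k : ℝ) + 1 - k = 1 by ring]
            rw [one_div, inv_le_inv₀ (by positivity) (by positivity)]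
            nlinarith
          linarith
        · have hk1 : k = 1 := by omega
          subst hk1
          norm_num
  rcases key N with h | h
  · have : (0 : ℝ) ≤ (N : ℝ)⁻¹ := by positivity
    linarith
  · rw [Finset.Icc_eq_empty (by omega), Finset.sum_empty]
    exact zero_le_one

/-- `exp(1/p) ≤ (1 + 1/p)(1 + 1/p²)` for `p ≥ 1` (from `|e^u − 1 − u| ≤ u²`, `|u| ≤ 1`). [folklore] -/
theorem exp_inv_le_mul (p : ℕ) (hp : 1 ≤ p) :
    Real.exp ((p : ℝ)⁻¹) ≤ (1 + (p : ℝ)⁻¹) * (1 + ((p : ℝ) ^ 2)⁻¹) := by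
  have hp1 : (1 : ℝ) ≤ p := by exact_mod_cast hp
  have hu0 : (0 : ℝ) ≤ (p : ℝ)⁻¹ := by positivity
  have hu1 : (p : ℝ)⁻¹ ≤ 1 := inv_le_one_of_one_le₀ hp1
  have h := Real.abs_exp_sub_one_sub_id_le (x := (p : ℝ)⁻¹) (by rwa [abs_of_nonneg hu0])
  have h' := (abs_le.1 h).2
  have hsq : ((p : ℝ)⁻¹) ^ 2 = ((p : ℝ) ^ 2)⁻¹ := by rw [inv_pow]
  rw [hsq] at h'
  have hv0 : (0 : ℝ) ≤ ((p : ℝ) ^ 2)⁻¹ := by positivity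
  nlinarith [mul_nonneg hu0 hv0]

/-- **Mertens-type bound**: `exp (∑_{p ≤ x prime} 1/p) ≤ e⁶ log x / log 2` for `x ≥ 2`, from the
tree's `∏_{p ≤ x} (1 + 1/p) ≤ e⁵ log x / log 2` (`BombieriSieve.prod_primesGe_one_add_inv_le`) and
`∏ (1 + 1/p²) ≤ exp(∑_{n ≥ 2} 1/n²) ≤ e`. [folklore] -/
theorem exp_sum_primes_inv_le {x : ℝ} (hx : 2 ≤ x) :
    Real.exp (∑ p ∈ (Icc 1 ⌊x⌋₊).filter Nat.Prime, (p : ℝ)⁻¹) ≤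
      Real.exp 6 * Real.log x / Real.log 2 := by
  set P := (Icc 1 ⌊x⌋₊).filter Nat.Prime with hP
  have hPprime : ∀ p ∈ P, p.Prime := fun p hp => (Finset.mem_filter.1 hp).2
  -- `exp (∑ 1/p) = ∏ exp(1/p) ≤ ∏ (1+1/p) * ∏ (1 + 1/p²)`
  rw [Real.exp_sum]
  have h1 : ∏ p ∈ P, Real.exp ((p : ℝ)⁻¹) ≤
      (∏ p ∈ P, (1 + (p : ℝ)⁻¹)) * ∏ p ∈ P, (1 + ((p : ℝ) ^ 2)⁻¹) := by
    rw [← Finset.prod_mul_distrib]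
    exact Finset.prod_le_prod (fun p _ => (Real.exp_pos _).le)
      fun p hp => exp_inv_le_mul p (hPprime p hp).one_lt.le
  refine h1.trans ?_
  -- second product `≤ e`
  have h2 : ∏ p ∈ P, (1 + ((p : ℝ) ^ 2)⁻¹) ≤ Real.exp 1 := by
    calc ∏ p ∈ P, (1 + ((p : ℝ) ^ 2)⁻¹) ≤ ∏ p ∈ P, Real.exp (((p : ℝ) ^ 2)⁻¹) :=
          Finset.prod_le_prod (fun p _ => by positivity) fun p _ => by
            linarith [Real.add_one_le_exp (((p : ℝ) ^ 2)⁻¹)]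
      _ = Real.exp (∑ p ∈ P, ((p : ℝ) ^ 2)⁻¹) := (Real.exp_sum _ _).symm
      _ ≤ Real.exp 1 := by
          refine Real.exp_le_exp.2 ?_
          calc ∑ p ∈ P, ((p : ℝ) ^ 2)⁻¹ ≤ ∑ n ∈ Icc 2 ⌊x⌋₊, ((n : ℝ) ^ 2)⁻¹ := by
                refine Finset.sum_le_sum_of_subset_of_nonneg (fun p hp => ?_) fun _ _ _ => by positivity
                have hp' := Finset.mem_filter.1 hp
                exact Finset.mem_Icc.2 ⟨hp'.2.two_le, (Finset.mem_Icc.1 hp'.1).2⟩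
            _ ≤ 1 := sum_Icc_inv_sq_le_one _
  -- first product: the tree's Mertens quotient bound with `z = 2`
  have h3 : ∏ p ∈ P, (1 + (p : ℝ)⁻¹) ≤ Real.exp 5 * Real.log x / Real.log 2 := by
    have hset : P = (Nat.primesLE ⌊x⌋₊).filter (fun p : ℕ => (2 : ℝ) ≤ (p : ℝ)) := by
      ext p
      simp only [hP, Finset.mem_filter, Finset.mem_Icc, Nat.mem_primesLE]
      constructor
      · rintro ⟨⟨-, hpx⟩, hp⟩; exact ⟨⟨hpx, hp⟩, by exact_mod_cast hp.two_le⟩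
      · rintro ⟨⟨hpx, hp⟩, -⟩; exact ⟨⟨hp.one_lt.le, hpx⟩, hp⟩
    rw [hset]
    exact BombieriSieve.prod_primesGe_one_add_inv_le le_rfl hx
  have hlog2 : 0 < Real.log 2 := Real.log_pos one_lt_two
  have hlogx : 0 ≤ Real.log x := Real.log_nonneg (by linarith)
  calc (∏ p ∈ P, (1 + (p : ℝ)⁻¹)) * ∏ p ∈ P, (1 + ((p : ℝ) ^ 2)⁻¹)
      ≤ (Real.exp 5 * Real.log x / Real.log 2) * Real.exp 1 :=
        mul_le_mul h3 h2 (Finset.prod_nonneg fun _ _ => by positivity) (by positivity)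
    _ = Real.exp 6 * Real.log x / Real.log 2 := by
        rw [show (6 : ℝ) = 5 + 1 by norm_num, Real.exp_add]; ring

/-! ### Moments of `τ`: `∑_{n ≤ X} τ(n)^r / n ≪_r (log X)^{2^{r+1}}` -/

/-- `(e + 1)^r ≤ 2^r e^r + 2^r` for natural `e` (case `e = 0` and `e + 1 ≤ 2e`). [folklore] -/
theorem succ_pow_le (r e : ℕ) : ((e : ℝ) + 1) ^ r ≤ (2 : ℝ) ^ r * (e : ℝ) ^ r + (2 : ℝ) ^ r := by
  rcases Nat.eq_zero_or_pos e with rfl | he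
  · have h1 : (1 : ℝ) ≤ 2 ^ r := one_le_pow₀ (by norm_num)
    have h2 : (0 : ℝ) ≤ 2 ^ r * 0 ^ r := by positivity
    simp only [Nat.cast_zero, zero_add, one_pow]
    linarith
  · have h1 : (e : ℝ) + 1 ≤ 2 * e := by
      have : (1 : ℝ) ≤ e := by exact_mod_cast he
      linarith
    calc ((e : ℝ) + 1) ^ r ≤ (2 * (e : ℝ)) ^ r := pow_le_pow_left₀ (by positivity) h1 r
      _ = (2 : ℝ) ^ r * (e : ℝ) ^ r := mul_pow _ _ _
      _ ≤ (2 : ℝ) ^ r * (e : ℝ) ^ r + (2 : ℝ) ^ r := le_add_of_nonneg_right (by positivity)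

/-- The local Euler factors of `τ^r`: `e ↦ (e+1)^r u^e` is summable for `0 ≤ u < 1`. [folklore] -/
theorem summable_succ_pow_mul_pow (r : ℕ) {u : ℝ} (hu0 : 0 ≤ u) (hu1 : u < 1) :
    Summable (fun e : ℕ => ((e : ℝ) + 1) ^ r * u ^ e) := by
  have hg : Summable (fun e : ℕ => ((e : ℝ) ^ r : ℝ) * u ^ e) :=
    summable_pow_mul_geometric_of_norm_lt_one r (by rwa [Real.norm_of_nonneg hu0])
  have hgeo : Summable (fun e : ℕ => u ^ e) := summable_geometric_of_lt_one hu0 hu1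
  have hmaj : Summable (fun e : ℕ => (2 : ℝ) ^ r * ((e : ℝ) ^ r * u ^ e) + (2 : ℝ) ^ r * u ^ e) :=
    (hg.mul_left _).add (hgeo.mul_left _)
  refine Summable.of_nonneg_of_le (fun e => by positivity) (fun e => ?_) hmaj
  have hue : 0 ≤ u ^ e := pow_nonneg hu0 e
  calc ((e : ℝ) + 1) ^ r * u ^ e ≤ ((2 : ℝ) ^ r * (e : ℝ) ^ r + (2 : ℝ) ^ r) * u ^ e :=
        mul_le_mul_of_nonneg_right (succ_pow_le r e) hue
    _ = (2 : ℝ) ^ r * ((e : ℝ) ^ r * u ^ e) + (2 : ℝ) ^ r * u ^ e := by ring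

/-- `(e + 1)^r ≤ (2^r)^e` (`e + 1 ≤ 2^e`). [folklore] -/
theorem succ_pow_le_two_pow_pow (r e : ℕ) : ((e : ℝ) + 1) ^ r ≤ ((2 : ℝ) ^ r) ^ e := by
  have h : (e : ℝ) + 1 ≤ (2 : ℝ) ^ e := by exact_mod_cast (Nat.lt_two_pow_self (n := e))
  calc ((e : ℝ) + 1) ^ r ≤ ((2 : ℝ) ^ e) ^ r := pow_le_pow_left₀ (by positivity) h r
    _ = ((2 : ℝ) ^ r) ^ e := by rw [← pow_mul, ← pow_mul, mul_comm]

/-- **Moments of the divisor function, logarithmic form**: for every `r` there is `C_r > 0` with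
`∑_{n ≤ X} τ(n)^r / n ≤ C_r (log X)^{2^{r+1}}` for all `X ≥ 2`.  Proof: `n ↦ τ(n)^r/n` is
nonnegative and multiplicative, so the sum is at most the Euler product `∏_{p ≤ X} ∑_e (e+1)^r p^{−e}`
(Mathlib's Euler product over factored numbers, via the tree's `sum_le_prod_tsum_of_factored`); the
factors at `p ≤ 2^{r+1}` are bounded by the constant `∑_e (e+1)^r 2^{−e}`, those at `p > 2^{r+1}` by
`(1 − 2^r/p)⁻¹ ≤ 1 + 2^{r+1}/p ≤ (1 + 1/p)^{2^{r+1}}`, and `∏_{p ≤ X}(1 + 1/p) ≤ e⁵ log X / log 2`.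
[cite: MontgomeryVaughan2007, §2.3 and §7.1] -/
theorem exists_sum_sigma_zero_pow_div_le (r : ℕ) :
    ∃ C : ℝ, 0 < C ∧ ∀ X : ℕ, 2 ≤ X →
      ∑ n ∈ Icc 1 X, (σ 0 n : ℝ) ^ r / n ≤ C * Real.log X ^ (2 ^ (r + 1)) := by
  -- the constant factor `K = ∑_e (e+1)^r 2^{-e} ≥ 1`
  have hKsum : Summable (fun e : ℕ => ((e : ℝ) + 1) ^ r * (2⁻¹ : ℝ) ^ e) :=
    summable_succ_pow_mul_pow r (by norm_num) (by norm_num)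
  set K : ℝ := ∑' e : ℕ, ((e : ℝ) + 1) ^ r * (2⁻¹ : ℝ) ^ e with hK
  have hK1 : 1 ≤ K := by
    have h := hKsum.sum_le_tsum {0} (fun e _ => by positivity)
    calc (1 : ℝ) = ∑ e ∈ ({0} : Finset ℕ), ((e : ℝ) + 1) ^ r * (2⁻¹ : ℝ) ^ e := by simp
      _ ≤ K := h
  set c : ℕ := 2 ^ (r + 1) with hc
  have hlog2 : 0 < Real.log 2 := Real.log_pos one_lt_two
  refine ⟨K ^ (c + 1) * (Real.exp 5 / Real.log 2) ^ c, by positivity, fun X hX => ?_⟩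
  have hX2 : (2 : ℝ) ≤ X := by exact_mod_cast hX
  -- the multiplicative function `h(n) = τ(n)^r / n`
  set h : ℕ → ℝ := fun n => (σ 0 n : ℝ) ^ r / n with hh
  have h1 : h 1 = 1 := by simp [hh, ArithmeticFunction.sigma_zero_apply]
  have hmul : ∀ {m n : ℕ}, Nat.Coprime m n → h (m * n) = h m * h n := by
    intro m n hmn
    simp only [hh]
    rw [ArithmeticFunction.isMultiplicative_sigma.map_mul_of_coprime hmn]
    push_cast
    rw [mul_pow, div_mul_div_comm]
  have h0 : ∀ n, 0 ≤ h n := fun n => by positivity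
  have hpe : ∀ {p : ℕ}, p.Prime → ∀ e : ℕ,
      h (p ^ e) = ((e : ℝ) + 1) ^ r * ((p : ℝ)⁻¹) ^ e := by
    intro p hp e
    simp only [hh]
    rw [ArithmeticFunction.sigma_zero_apply_prime_pow hp]
    push_cast
    rw [inv_pow, div_eq_mul_inv]
  have hpinv : ∀ {p : ℕ}, p.Prime → 0 ≤ (p : ℝ)⁻¹ ∧ (p : ℝ)⁻¹ < 1 := fun hp =>
    ⟨by positivity, inv_lt_one_of_one_lt₀ (by exact_mod_cast hp.one_lt)⟩
  have hsum : ∀ {p : ℕ}, p.Prime → Summable (fun e : ℕ => h (p ^ e)) := by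
    intro p hp
    simp_rw [hpe hp]
    exact summable_succ_pow_mul_pow r (hpinv hp).1 (hpinv hp).2
  -- the set of primes `≤ X`
  set s := (Nat.primesLE X).filter (fun p : ℕ => (2 : ℝ) ≤ (p : ℝ)) with hs_def
  have hs : ∀ p ∈ s, p.Prime := fun p hp => (Nat.mem_primesLE.1 (Finset.mem_filter.1 hp).1).2
  have hD : ∀ n ∈ Icc 1 X, n ∈ Nat.factoredNumbers s := by
    intro n hn
    rw [Finset.mem_Icc] at hn
    rw [Nat.mem_factoredNumbers']
    intro p hp hpn
    rw [hs_def, Finset.mem_filter, Nat.mem_primesLE]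
    exact ⟨⟨(Nat.le_of_dvd hn.1 hpn).trans hn.2, hp⟩, by exact_mod_cast hp.two_le⟩
  have hstep : ∑ n ∈ Icc 1 X, h n ≤ ∏ p ∈ s, ∑' e : ℕ, h (p ^ e) :=
    BombieriSieve.sum_le_prod_tsum_of_factored h1 hmul h0 hsum hs hD
  -- bounds for the local factors
  have hTK : ∀ p ∈ s, ∑' e : ℕ, h (p ^ e) ≤ K := by
    intro p hp
    have hp' := hs p hp
    simp_rw [hpe hp']
    refine (summable_succ_pow_mul_pow r (hpinv hp').1 (hpinv hp').2).tsum_mono hKsum fun e => ?_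
    have : (p : ℝ)⁻¹ ≤ 2⁻¹ := by
      rw [inv_le_inv₀ (by exact_mod_cast hp'.pos) (by norm_num)]
      exact_mod_cast hp'.two_le
    exact mul_le_mul_of_nonneg_left (pow_le_pow_left₀ (hpinv hp').1 this e) (by positivity)
  have hT1 : ∀ p ∈ s, 1 ≤ ∑' e : ℕ, h (p ^ e) := by
    intro p hp
    have h := (hsum (hs p hp)).sum_le_tsum {0} (fun e _ => h0 _)
    simpa [h1] using h
  have hTbig : ∀ p ∈ s, ¬ p ≤ c → ∑' e : ℕ, h (p ^ e) ≤ (1 + (p : ℝ)⁻¹) ^ c := by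
    intro p hp hpc
    have hp' := hs p hp
    rw [not_le] at hpc
    have hp0 : (0 : ℝ) < p := by exact_mod_cast hp'.pos
    -- `v = 2^r / p ≤ 1/2`
    set v : ℝ := (2 : ℝ) ^ r * (p : ℝ)⁻¹ with hv
    have hv0 : 0 ≤ v := by positivity
    have hvhalf : v ≤ 1 / 2 := by
      have hcp : (2 : ℝ) ^ (r + 1) ≤ p := by exact_mod_cast hpc.le
      rw [hv, ← div_eq_mul_inv, div_le_iff₀ hp0]
      rw [pow_succ] at hcp
      linarith
    have hv1 : v < 1 := by linarith
    calc ∑' e : ℕ, h (p ^ e) ≤ ∑' e : ℕ, v ^ e := by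
          simp_rw [hpe hp']
          refine (summable_succ_pow_mul_pow r (hpinv hp').1 (hpinv hp').2).tsum_mono
            (summable_geometric_of_lt_one hv0 hv1) fun e => ?_
          rw [hv, mul_pow]
          exact mul_le_mul_of_nonneg_right (succ_pow_le_two_pow_pow r e) (pow_nonneg (hpinv hp').1 e)
      _ = (1 - v)⁻¹ := tsum_geometric_of_lt_one hv0 hv1
      _ ≤ 1 + 2 * v := by
          rw [inv_eq_one_div, div_le_iff₀ (by linarith)]
          nlinarith
      _ = 1 + (c : ℝ) * (p : ℝ)⁻¹ := by rw [hv, hc]; push_cast; ring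
      _ ≤ (1 + (p : ℝ)⁻¹) ^ c := one_add_mul_le_pow (by linarith [(hpinv hp').1]) c
  -- split the product at `p ≤ c`
  have hsplit := (Finset.prod_filter_mul_prod_filter_not s (fun p : ℕ => p ≤ c)
    (fun p => ∑' e : ℕ, h (p ^ e))).symm
  have hsmall : ∏ p ∈ s.filter (fun p : ℕ => p ≤ c), ∑' e : ℕ, h (p ^ e) ≤ K ^ (c + 1) := by
    calc ∏ p ∈ s.filter (fun p : ℕ => p ≤ c), ∑' e : ℕ, h (p ^ e)
        ≤ ∏ p ∈ s.filter (fun p : ℕ => p ≤ c), K :=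
          Finset.prod_le_prod (fun p hp => (zero_le_one.trans (hT1 p (Finset.mem_filter.1 hp).1)))
            fun p hp => hTK p (Finset.mem_filter.1 hp).1
      _ = K ^ (s.filter (fun p : ℕ => p ≤ c)).card := Finset.prod_const K
      _ ≤ K ^ (c + 1) := by
          refine pow_le_pow_right₀ hK1 ?_
          calc (s.filter (fun p : ℕ => p ≤ c)).card ≤ (Finset.Iic c).card :=
                Finset.card_le_card fun p hp => Finset.mem_Iic.2 (Finset.mem_filter.1 hp).2
            _ = c + 1 := Nat.card_Iic c
  have hbig : ∏ p ∈ s.filter (fun p : ℕ => ¬ p ≤ c), ∑' e : ℕ, h (p ^ e) ≤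
      (Real.exp 5 * Real.log X / Real.log 2) ^ c := by
    calc ∏ p ∈ s.filter (fun p : ℕ => ¬ p ≤ c), ∑' e : ℕ, h (p ^ e)
        ≤ ∏ p ∈ s.filter (fun p : ℕ => ¬ p ≤ c), (1 + (p : ℝ)⁻¹) ^ c :=
          Finset.prod_le_prod (fun p hp => (zero_le_one.trans (hT1 p (Finset.mem_filter.1 hp).1)))
            fun p hp => hTbig p (Finset.mem_filter.1 hp).1 (Finset.mem_filter.1 hp).2
      _ ≤ ∏ p ∈ s, (1 + (p : ℝ)⁻¹) ^ c := by
          have hge1 : ∀ p ∈ s, (1 : ℝ) ≤ (1 + (p : ℝ)⁻¹) ^ c := fun p _ =>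
            one_le_pow₀ (le_add_of_nonneg_right (by positivity))
          rw [← Finset.prod_filter_mul_prod_filter_not s (fun p : ℕ => p ≤ c)]
          have hP : (1 : ℝ) ≤ ∏ p ∈ s.filter (fun p : ℕ => p ≤ c), (1 + (p : ℝ)⁻¹) ^ c :=
            calc (1 : ℝ) = ∏ p ∈ s.filter (fun p : ℕ => p ≤ c), (1 : ℝ) := Finset.prod_const_one.symm
              _ ≤ ∏ p ∈ s.filter (fun p : ℕ => p ≤ c), (1 + (p : ℝ)⁻¹) ^ c :=
                Finset.prod_le_prod (fun _ _ => zero_le_one) fun p hp => hge1 p (Finset.mem_filter.1 hp).1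
          have hQ : (0 : ℝ) ≤ ∏ p ∈ s.filter (fun p : ℕ => ¬ p ≤ c), (1 + (p : ℝ)⁻¹) ^ c :=
            Finset.prod_nonneg fun _ _ => by positivity
          calc ∏ p ∈ s.filter (fun p : ℕ => ¬ p ≤ c), (1 + (p : ℝ)⁻¹) ^ c
              = 1 * ∏ p ∈ s.filter (fun p : ℕ => ¬ p ≤ c), (1 + (p : ℝ)⁻¹) ^ c := (one_mul _).symm
            _ ≤ (∏ p ∈ s.filter (fun p : ℕ => p ≤ c), (1 + (p : ℝ)⁻¹) ^ c) *
                  ∏ p ∈ s.filter (fun p : ℕ => ¬ p ≤ c), (1 + (p : ℝ)⁻¹) ^ c :=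
                mul_le_mul_of_nonneg_right hP hQ
      _ = (∏ p ∈ s, (1 + (p : ℝ)⁻¹)) ^ c := Finset.prod_pow _ _ _
      _ ≤ (Real.exp 5 * Real.log X / Real.log 2) ^ c := by
          refine pow_le_pow_left₀ (Finset.prod_nonneg fun _ _ => by positivity) ?_ c
          have := BombieriSieve.prod_primesGe_one_add_inv_le (z := 2) (x := (X : ℝ)) le_rfl hX2
          rwa [Nat.floor_natCast] at this
  have hlogX : 0 ≤ Real.log X := Real.log_nonneg (by linarith)
  calc ∑ n ∈ Icc 1 X, (σ 0 n : ℝ) ^ r / n = ∑ n ∈ Icc 1 X, h n := rfl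
    _ ≤ ∏ p ∈ s, ∑' e : ℕ, h (p ^ e) := hstep
    _ = (∏ p ∈ s.filter (fun p : ℕ => p ≤ c), ∑' e : ℕ, h (p ^ e)) *
          ∏ p ∈ s.filter (fun p : ℕ => ¬ p ≤ c), ∑' e : ℕ, h (p ^ e) := hsplit
    _ ≤ K ^ (c + 1) * (Real.exp 5 * Real.log X / Real.log 2) ^ c :=
        mul_le_mul hsmall hbig (Finset.prod_nonneg fun p hp =>
          zero_le_one.trans (hT1 p (Finset.mem_filter.1 hp).1)) (by positivity)
    _ = K ^ (c + 1) * (Real.exp 5 / Real.log 2) ^ c * Real.log X ^ c := by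
        rw [mul_div_right_comm, mul_pow]; ring

/-- **Moments of the divisor function**: for every `r` there is `C_r > 0` with
`∑_{n ≤ X} τ(n)^r ≤ C_r X (log X)^{2^{r+1}}` for all `X ≥ 2` (from the logarithmic form:
`τ(n)^r ≤ X · τ(n)^r / n` for `n ≤ X`). [cite: MontgomeryVaughan2007, §2.3] -/
theorem exists_sum_sigma_zero_pow_le (r : ℕ) :
    ∃ C : ℝ, 0 < C ∧ ∀ X : ℕ, 2 ≤ X →
      ∑ n ∈ Icc 1 X, (σ 0 n : ℝ) ^ r ≤ C * X * Real.log X ^ (2 ^ (r + 1)) := by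
  obtain ⟨C, hC, h⟩ := exists_sum_sigma_zero_pow_div_le r
  refine ⟨C, hC, fun X hX => ?_⟩
  calc ∑ n ∈ Icc 1 X, (σ 0 n : ℝ) ^ r ≤ ∑ n ∈ Icc 1 X, (X : ℝ) * ((σ 0 n : ℝ) ^ r / n) := by
        refine Finset.sum_le_sum fun n hn => ?_
        rw [Finset.mem_Icc] at hn
        have hn0 : (0 : ℝ) < n := by exact_mod_cast hn.1
        rw [mul_div_assoc', le_div_iff₀ hn0]
        exact mul_comm (X : ℝ) _ ▸ mul_le_mul_of_nonneg_left (by exact_mod_cast hn.2) (by positivity)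
    _ = (X : ℝ) * ∑ n ∈ Icc 1 X, (σ 0 n : ℝ) ^ r / n := (Finset.mul_sum _ _ _).symm
    _ ≤ (X : ℝ) * (C * Real.log X ^ (2 ^ (r + 1))) :=
        mul_le_mul_of_nonneg_left (h X hX) (Nat.cast_nonneg X)
    _ = C * X * Real.log X ^ (2 ^ (r + 1)) := by ring

/-- Real-variable form: `∑_{n ≤ x} τ(n)^r ≤ C_r x (log x)^{2^{r+1}}` for real `x ≥ 2`. [folklore] -/
theorem exists_sum_sigma_zero_pow_le_real (r : ℕ) :
    ∃ C : ℝ, 0 < C ∧ ∀ x : ℝ, 2 ≤ x →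
      ∑ n ∈ Icc 1 ⌊x⌋₊, (σ 0 n : ℝ) ^ r ≤ C * x * Real.log x ^ (2 ^ (r + 1)) := by
  obtain ⟨C, hC, h⟩ := exists_sum_sigma_zero_pow_le r
  refine ⟨C, hC, fun x hx => ?_⟩
  have hX : 2 ≤ ⌊x⌋₊ := Nat.le_floor (by exact_mod_cast hx)
  have hx0 : 0 < x := by linarith
  have hXx : (⌊x⌋₊ : ℝ) ≤ x := Nat.floor_le hx0.le
  have hX2 : (2 : ℝ) ≤ ⌊x⌋₊ := by exact_mod_cast hX
  have hlog : Real.log ⌊x⌋₊ ≤ Real.log x := Real.log_le_log (by linarith) hXx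
  have hlog0 : 0 ≤ Real.log ⌊x⌋₊ := Real.log_nonneg (by linarith)
  calc ∑ n ∈ Icc 1 ⌊x⌋₊, (σ 0 n : ℝ) ^ r ≤ C * ⌊x⌋₊ * Real.log ⌊x⌋₊ ^ (2 ^ (r + 1)) := h _ hX
    _ ≤ C * x * Real.log x ^ (2 ^ (r + 1)) := by gcongr

/-- Real-variable logarithmic form: `∑_{n ≤ x} τ(n)^r / n ≤ C_r (log x)^{2^{r+1}}` for `x ≥ 2`.
[folklore] -/
theorem exists_sum_sigma_zero_pow_div_le_real (r : ℕ) :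
    ∃ C : ℝ, 0 < C ∧ ∀ x : ℝ, 2 ≤ x →
      ∑ n ∈ Icc 1 ⌊x⌋₊, (σ 0 n : ℝ) ^ r / n ≤ C * Real.log x ^ (2 ^ (r + 1)) := by
  obtain ⟨C, hC, h⟩ := exists_sum_sigma_zero_pow_div_le r
  refine ⟨C, hC, fun x hx => ?_⟩
  have hX : 2 ≤ ⌊x⌋₊ := Nat.le_floor (by exact_mod_cast hx)
  have hx0 : 0 < x := by linarith
  have hXx : (⌊x⌋₊ : ℝ) ≤ x := Nat.floor_le hx0.le
  have hX2 : (2 : ℝ) ≤ ⌊x⌋₊ := by exact_mod_cast hX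
  have hlog : Real.log ⌊x⌋₊ ≤ Real.log x := Real.log_le_log (by linarith) hXx
  have hlog0 : 0 ≤ Real.log ⌊x⌋₊ := Real.log_nonneg (by linarith)
  calc ∑ n ∈ Icc 1 ⌊x⌋₊, (σ 0 n : ℝ) ^ r / n ≤ C * Real.log ⌊x⌋₊ ^ (2 ^ (r + 1)) := h _ hX
    _ ≤ C * Real.log x ^ (2 ^ (r + 1)) := by gcongr

/-- `∑_{d ≤ x} τ(d)^r / φ(d) ≤ C_r (log x)^{2^{r+2}}` for `x ≥ 2` (via `1/φ(d) ≤ τ(d)/d`). [folklore] -/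
theorem exists_sum_sigma_zero_pow_div_totient_le_real (r : ℕ) :
    ∃ C : ℝ, 0 < C ∧ ∀ x : ℝ, 2 ≤ x →
      ∑ d ∈ Icc 1 ⌊x⌋₊, (σ 0 d : ℝ) ^ r / (Nat.totient d : ℝ) ≤ C * Real.log x ^ (2 ^ (r + 2)) := by
  obtain ⟨C, hC, h⟩ := exists_sum_sigma_zero_pow_div_le_real (r + 1)
  refine ⟨C, hC, fun x hx => le_trans (Finset.sum_le_sum fun d hd => ?_) (h x hx)⟩
  rw [div_eq_mul_inv, pow_succ, mul_div_assoc]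
  exact mul_le_mul_of_nonneg_left (inv_totient_le_sigma_zero_div d) (by positivity)

/-! ### Shiu's theorem for `τ^r` -/

/-- **Shiu's Brun–Titchmarsh theorem for `f = τ^r`** (P. Shiu 1980, Theorem 1, through the named
fact `Literature.NumberTheory.Sieve.Shiu1980BrunTitchmarsh`; the shape of BFI Lemma 3, p. 211): for `r ≥ 0` and
`0 < ε, θ < 1/2` there are `C, x₀` such that for `x ≥ x₀`, `x^ε ≤ y ≤ x`, `1 ≤ q < y^{1−θ}` and
`(a, q) = 1`: `∑_{x < n ≤ x+y, n ≡ a (q)} τ(n)^r ≤ C · y/φ(q) · (log x)^{2^r − 1}`.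
PROVED from the fact: `τ^r` is nonnegative and multiplicative, `τ(p^l)^r = (l+1)^r ≤ (2^r)^l`,
`τ(n)^r ≤ A(δ) n^δ` (`DivisorBound`), and `exp(∑_{p≤x} τ(p)^r/p) ≤ (e⁶ log x / log 2)^{2^r}`
(`exp_sum_primes_inv_le`). [cite: Shiu1980, Theorem 1] -/
theorem Shiu1980BrunTitchmarsh.sigma_zero_pow (hS : Shiu1980BrunTitchmarsh) (r : ℕ) {ε θ : ℝ}
    (hε : 0 < ε) (hε' : ε < 1 / 2) (hθ : 0 < θ) (hθ' : θ < 1 / 2) :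
    ∃ C x₀ : ℝ, 0 ≤ C ∧ ∀ x y : ℝ, x₀ ≤ x → x ^ ε ≤ y → y ≤ x →
      ∀ q : ℕ, 1 ≤ q → (q : ℝ) < y ^ (1 - θ) → ∀ a : ℕ, a.Coprime q →
        ∑ n ∈ (Icc 1 ⌊x + y⌋₊).filter (fun n : ℕ => x < n ∧ (n : ZMod q) = (a : ZMod q)),
            (σ 0 n : ℝ) ^ r ≤
          C * y / (Nat.totient q : ℝ) * Real.log x ^ (2 ^ r - 1) := by
  -- the function and its structural properties
  set f : ℕ → ℝ := fun n => (σ 0 n : ℝ) ^ r with hf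
  have hf0 : ∀ n, 0 ≤ f n := fun n => by positivity
  have hfmul : ∀ m n : ℕ, m.Coprime n → f (m * n) = f m * f n := by
    intro m n hmn
    simp only [hf]
    rw [ArithmeticFunction.isMultiplicative_sigma.map_mul_of_coprime hmn]
    push_cast
    ring
  have hfpp : ∀ p l : ℕ, p.Prime → 1 ≤ l → f (p ^ l) ≤ ((2 : ℝ) ^ r) ^ l := by
    intro p l hp _
    simp only [hf]
    rw [ArithmeticFunction.sigma_zero_apply_prime_pow hp]
    push_cast
    exact succ_pow_le_two_pow_pow r l
  -- the divisor bound `τ(n)^r ≤ A₂(δ) n^δ`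
  classical
  set A₂ : ℝ → ℝ := fun δ =>
    if h : 0 < δ ∧ 0 < r then
      (Classical.choose (exists_sigma_zero_le_mul_rpow (div_pos h.1 (Nat.cast_pos.2 h.2)))) ^ r
    else 1 with hA₂
  have hfA₂ : ∀ δ : ℝ, 0 < δ → ∀ n : ℕ, 1 ≤ n → f n ≤ A₂ δ * (n : ℝ) ^ δ := by
    intro δ hδ n hn
    simp only [hf, hA₂]
    rcases Nat.eq_zero_or_pos r with hr | hr
    · subst hr
      simp only [pow_zero, lt_self_iff_false, and_false, dite_false, one_mul]
      exact Real.one_le_rpow (by exact_mod_cast hn) hδ.le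
    · rw [dif_pos ⟨hδ, hr⟩]
      set Cδ := Classical.choose (exists_sigma_zero_le_mul_rpow (div_pos hδ (Nat.cast_pos.2 hr)))
      obtain ⟨hC1, hCn⟩ := Classical.choose_spec (exists_sigma_zero_le_mul_rpow (div_pos hδ (Nat.cast_pos.2 hr)))
      have hn0 : (0 : ℝ) ≤ n := Nat.cast_nonneg n
      calc (σ 0 n : ℝ) ^ r ≤ (Cδ * (n : ℝ) ^ (δ / r)) ^ r :=
            pow_le_pow_left₀ (Nat.cast_nonneg _) (hCn n) r
        _ = Cδ ^ r * (n : ℝ) ^ δ := by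
            rw [mul_pow, ← Real.rpow_natCast ((n : ℝ) ^ (δ / r)) r, ← Real.rpow_mul hn0]
            congr 2
            field_simp
  obtain ⟨C, x₀, hC⟩ := hS f hf0 hfmul ((2 : ℝ) ^ r) hfpp A₂ hfA₂ ε θ hε hε' hθ hθ'
  -- the Mertens factor
  have hlog2 : 0 < Real.log 2 := Real.log_pos one_lt_two
  set E : ℝ := (Real.exp 6 / Real.log 2) ^ (2 ^ r) with hE
  refine ⟨max C 0 * E, max x₀ 2, by positivity, fun x y hx hxy hyx q hq hqy a ha => ?_⟩
  have hx₀ : x₀ ≤ x := (le_max_left _ _).trans hx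
  have hx2 : 2 ≤ x := (le_max_right _ _).trans hx
  have hlogx : 0 < Real.log x := Real.log_pos (by linarith)
  have hy0 : 0 < y := lt_of_lt_of_le (Real.rpow_pos_of_pos (by linarith) ε) hxy
  have hφ : (0 : ℝ) < Nat.totient q := by exact_mod_cast Nat.totient_pos.2 hq
  have h1 := hC x y hx₀ hxy hyx q hq hqy a ha
  -- bound the exponential factor
  have hexp : Real.exp (∑ p ∈ (Icc 1 ⌊x⌋₊).filter (fun p : ℕ => p.Prime ∧ ¬p ∣ q), f p / p) ≤
      E * Real.log x ^ (2 ^ r) := by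
    have hle : ∑ p ∈ (Icc 1 ⌊x⌋₊).filter (fun p : ℕ => p.Prime ∧ ¬p ∣ q), f p / p ≤
        (2 : ℝ) ^ r * ∑ p ∈ (Icc 1 ⌊x⌋₊).filter Nat.Prime, (p : ℝ)⁻¹ := by
      calc ∑ p ∈ (Icc 1 ⌊x⌋₊).filter (fun p : ℕ => p.Prime ∧ ¬p ∣ q), f p / p
          = ∑ p ∈ (Icc 1 ⌊x⌋₊).filter (fun p : ℕ => p.Prime ∧ ¬p ∣ q), (2 : ℝ) ^ r * (p : ℝ)⁻¹ := by
            refine Finset.sum_congr rfl fun p hp => ?_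
            have hp' := (Finset.mem_filter.1 hp).2.1
            have h2 : (σ 0 p : ℝ) = 2 := by
              have := ArithmeticFunction.sigma_zero_apply_prime_pow hp' (i := 1)
              rw [pow_one] at this
              rw [this]; norm_num
            simp only [hf]
            rw [h2, div_eq_mul_inv]
        _ ≤ ∑ p ∈ (Icc 1 ⌊x⌋₊).filter Nat.Prime, (2 : ℝ) ^ r * (p : ℝ)⁻¹ :=
            Finset.sum_le_sum_of_subset_of_nonneg
              (fun p hp => by rw [Finset.mem_filter] at hp ⊢; exact ⟨hp.1, hp.2.1⟩)
              (fun p _ _ => by positivity)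
        _ = (2 : ℝ) ^ r * ∑ p ∈ (Icc 1 ⌊x⌋₊).filter Nat.Prime, (p : ℝ)⁻¹ := (Finset.mul_sum _ _ _).symm
    calc Real.exp (∑ p ∈ (Icc 1 ⌊x⌋₊).filter (fun p : ℕ => p.Prime ∧ ¬p ∣ q), f p / p)
        ≤ Real.exp ((2 : ℝ) ^ r * ∑ p ∈ (Icc 1 ⌊x⌋₊).filter Nat.Prime, (p : ℝ)⁻¹) :=
          Real.exp_le_exp.2 hle
      _ = (Real.exp (∑ p ∈ (Icc 1 ⌊x⌋₊).filter Nat.Prime, (p : ℝ)⁻¹)) ^ (2 ^ r) := by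
          rw [← Real.exp_nat_mul]; push_cast; ring_nf
      _ ≤ (Real.exp 6 * Real.log x / Real.log 2) ^ (2 ^ r) :=
          pow_le_pow_left₀ (Real.exp_pos _).le (exp_sum_primes_inv_le hx2) _
      _ = E * Real.log x ^ (2 ^ r) := by rw [hE, mul_div_right_comm, mul_pow]
  have h2r : (2 ^ r - 1 : ℕ) + 1 = 2 ^ r := Nat.sub_add_cancel Nat.one_le_two_pow
  calc ∑ n ∈ (Icc 1 ⌊x + y⌋₊).filter (fun n : ℕ => x < n ∧ (n : ZMod q) = (a : ZMod q)), (σ 0 n : ℝ) ^ r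
      ≤ C * y / ((Nat.totient q : ℝ) * Real.log x) *
          Real.exp (∑ p ∈ (Icc 1 ⌊x⌋₊).filter (fun p : ℕ => p.Prime ∧ ¬p ∣ q), f p / p) := h1
    _ ≤ max C 0 * y / ((Nat.totient q : ℝ) * Real.log x) * (E * Real.log x ^ (2 ^ r)) := by
        refine mul_le_mul ?_ hexp (Real.exp_pos _).le (by positivity)
        exact div_le_div_of_nonneg_right (mul_le_mul_of_nonneg_right (le_max_left _ _) hy0.le)
          (by positivity)
    _ = max C 0 * E * y / (Nat.totient q : ℝ) * (Real.log x ^ (2 ^ r) / Real.log x) := by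
        field_simp
    _ = max C 0 * E * y / (Nat.totient q : ℝ) * Real.log x ^ (2 ^ r - 1) := by
        congr 1
        rw [← h2r, pow_succ, mul_div_assoc, div_self hlogx.ne', mul_one, h2r]

end Literature.NumberTheory.Sieve
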